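import Summits.NavierStokesRegularity.NavierStokesRegularity.Theses.SelfMixingDichotomy
import Literature.Analysis.FluidPDE.SereginSverakPressureLocalTypeI
import Literature.Analysis.FluidPDE.NSBoundedHigherRegularityOfLemma61
import HarnessLib

/-!
# Route SelfMixingDichotomy · crux `SequentialTypeIExclusion` (S1): the sup-form from the SHARED
# conjecture `¬ LocalTypeISingularityExists`, at points without Type-II spikes

Helper file of the crux item stmt-NavierStokesRegularity-1424 (lands `--supports` that item; line
`registered`, lead c5). Context (see `…SequentialTypeIExclusionStructure.lean`): the crux S1 is, over
the tree, `NSI ∧ S1_sup` (`sequentialTypeIExclusion_iff`), and its Type-I half `S1_sup` ("a centred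
cubic Type-I bound `C(r; T, x₀) ≤ M`, `0 < r < r₁`, at a final-time point of a classical Leray–Hopf
solution forces boundedness near `(T, x₀)`") was derived from the NEGATION OF THE CENTRED conjecture
decl `Literature.Analysis.FluidPDE.TypeISingularityExists` (`supForm_of_not_typeISingularityExists`),
a statement no other route uses and which the Liouville conjecture (L) of
Koch–Nadirashvili–Seregin–Šverák is NOT known to settle (centred bounds only). The conjecture the
rest of the programme works with is Albritton–Barker's ALL-BALLS form
`Literature.Analysis.FluidPDE.LocalTypeISingularityExists` (first bullet of A–B 2019, Thm 1.1), which
(L) does refute in tree (`LiouvilleConjectureNS.not_nontrivialMildAncientTypeIExists_measurable` +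
`AlbrittonBarkerTypeICharacterization`). This file locates EXACTLY what separates the two for S1:

* `exists_zoom_suitableInBall` — packaging (any viscosity, any radius `R` with `R²/ν ≤ T`): the
  viscosity-normalising parabolic zoom of a classical Leray–Hopf solution about a final-time point
  is a suitable weak solution in the unit parabolic ball in the class of A–B Def. 2.1, with the
  zoomed classical gradient as weak gradient (the block of
  `SereginSverak2002.exists_zoom_typeIBound_lt_top`, radius made a parameter).
* `exists_zoom_typeIBound_lt_top_of_subballC` — if `C` is bounded on ALL parabolic sub-balls of some
  `Q_{R₀}(T, x₀)` (a Morrey-type cubic bound at the point), the zoom has finite A–B Type-I quantity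
  `𝐈(Q(0, 1/2)) < ∞` (scale invariance of `C` + the tree's `albrittonBarker2019_lemma_2_6_holds`,
  `C`-case).
* `supForm_of_not_localTypeISingularityExists_of_subballC` — HENCE: if no local Type-I singular point
  exists (`¬ LocalTypeISingularityExists`), a sub-ball (Morrey) cubic bound at a final-time point of
  the S1 class forces BDD. This is `S1_sup` with its centred hypothesis strengthened to all sub-balls,
  from the SHARED conjecture.
* (sequel file `…SupFormOfNoLocalTypeIRelRate.lean`) `subballC_of_supForm_of_relTypeI` — the centred
  bound PLUS a pointwise Type-I rate RELATIVE TO THE POINT, `max(‖x − x₀‖, √(T − t)) ‖u(t,x)‖ ≤ K` on some `Q_{r₂}(T, x₀)`, give the sub-ball bound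
  (sub-balls far from `(T,x₀)` in parabolic distance see `‖u‖ ≤ K/r'`, near ones sit inside
  `Q_{3r'}(T,x₀)`); no singular integral is needed.
* `supForm_of_not_localTypeISingularityExists_of_relTypeI` — HENCE `S1_sup` holds, from
  `¬ LocalTypeISingularityExists` alone, at every point where the blow-up carries no TYPE-II SPIKES
  relative to the point; equivalently (`typeIISpikes_of_not_bdd`) at a centred-Type-I final-time
  point which is NOT bounded, `sup_{Q_r(T,x₀)} max(‖x−x₀‖, √(T−t)) ‖u‖ = ∞` for every `r > 0`:
  thin spikes of super-Type-I amplitude must accumulate at the point (they are regular points of `u`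
  before `T`, cheap in `L³`, invisible to the centred quantities).

So the gap between the route's `¬ TypeISingularityExists` and the shared `¬ LocalTypeISingularityExists`
(⇐ (L)) is, for S1, precisely the scenario "centred Type-I point with accumulating Type-II spikes";
a planner restating S1's Type-I half (`RESTATEMENT.md` of the crux directory) can hang it on the
shared conjecture at the price of exactly that extra clause. Nothing here is specific to the liminf
form: the other open half of S1 (no scale-intermittency, `stub_windowsForceTypeI`) is untouched.

## References

* D. Albritton, T. Barker, J. Math. Fluid Mech. 21 (2019) = arXiv:1811.00502, Thm. 1.1, Def. 2.1,
  Lemma 2.6. [AlbrittonBarker2019]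
* G. Seregin, V. Šverák, Comm. PDE 34 (2009) 171–201 = arXiv:0804.1803, §2 (the parabolic zoom at a
  Type I point; centred vs. non-centred scale-invariant quantities). [SereginSverak2009]
* G. Seregin, J. Math. Sci. 143 (2007) = arXiv:math/0607537, Lemma 2.1 (b). [Seregin2006]
* G. Koch, N. Nadirashvili, G. Seregin, V. Šverák, Acta Math. 203 (2009) 83–105 (conjecture (L)). [KNSS2009]
-/

noncomputable section

set_option linter.dupNamespace false -- nested layout Summit.<S>.<Sub>, Sub = S (D-0017)

open Set Filter Topology MeasureTheory
open scoped ContDiff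

namespace Summit.NavierStokesRegularity.NavierStokesRegularity.Theorems.SequentialTypeIExclusion.Registered

open Literature.Analysis.FluidPDE Literature.Analysis.FluidPDE.SereginSverak2002 InnerProductSpace
  Function TopologicalSpace Metric
open scoped RealInnerProductSpace ENNReal NNReal

-- adapted from Literature/Analysis/FluidPDE/SereginSverakPressureLocalTypeI.lean
-- (`SereginSverak2002.exists_zoom_typeIBound_lt_top`: the packaging block, radius `R` a parameter)

/-- **The viscosity-normalising zoom about a final-time point is a suitable weak solution in the unit
parabolic ball (Albritton–Barker Def. 2.1).** For a classical solution on `[0, T)` (viscosity `ν > 0`)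
which is Leray–Hopf on `[0, T)`, a point `x₀` and a radius `R > 0` with `R²/ν ≤ T`: with the gauged
pressure `q = p − (p(·,0) − p̃(·,0))`, `α = R/ν`, `β = R²/ν` and `Φ(s, y) = (T + βs, x₀ + Ry)`, the
pair `v = α u ∘ Φ`, `π = α² q ∘ Φ` is a suitable weak solution of the unit-viscosity system in
`Q(0, 1)` in the class of A–B Def. 2.1 (`IsSuitableWeakSolutionInBall 1 0`: energy class from the
Leray–Hopf energy bound, square-integrable gradient from the dissipation bound, `π ∈ L^{3/2}` from the
slab integrability of the gauged pressure), and `(αR) ∇u ∘ Φ` is a weak spatial gradient of `v` there.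
[cite: AlbrittonBarker2019, Def. 2.1; SereginSverak2009, §2] -/
theorem exists_zoom_suitableInBall {ν T : ℝ}
    {u : ℝ → EuclideanSpace ℝ (Fin 3) → EuclideanSpace ℝ (Fin 3)}
    {p : ℝ → EuclideanSpace ℝ (Fin 3) → ℝ}
    (hν : 0 < ν) (hT : 0 < T)
    (hsol : IsClassicalNSSolutionOn (Ico 0 T) ν 0 u p) (hLH : IsLerayHopfOn T ν 0 (u 0) u)
    (x₀ : EuclideanSpace ℝ (Fin 3)) {R : ℝ} (hRpos : 0 < R) (hβT : R ^ 2 / ν ≤ T) :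
    IsSuitableWeakSolutionInBall 1 0 ((R / ν) • stPull (R ^ 2 / ν) R T x₀ u)
        ((R / ν) ^ 2 • stPull (R ^ 2 / ν) R T x₀
          fun t x => p t x - (p t 0 - normalisedPressure (u t) 0)) ∧
      HasWeakSpatialGradientOn (parabolicCylinderOpens 1 (0 : ℝ × EuclideanSpace ℝ (Fin 3)))
        ((R / ν) • stPull (R ^ 2 / ν) R T x₀ u)
        (((R / ν) * R) • stPull (R ^ 2 / ν) R T x₀ fun t x => fderiv ℝ (u t) x) := by
  set α : ℝ := R / ν with hα
  set β : ℝ := R ^ 2 / ν with hβdef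
  have hαpos : 0 < α := by positivity
  have hβpos : 0 < β := by positivity
  have hβeq : β = α * R := by rw [hβdef, hα]; field_simp
  -- the gauged pressure
  set q : ℝ → EuclideanSpace ℝ (Fin 3) → ℝ :=
    fun t x => p t x - (p t 0 - normalisedPressure (u t) 0) with hq
  -- the `ν`-cylinder `(T - β, T) × B(x₀, R)` inside the slab, and its preimage `Q(0,1)`
  set PO : Opens (ℝ × EuclideanSpace ℝ (Fin 3)) :=
    ⟨Ioo (T - β) T ×ˢ ball x₀ R, isOpen_Ioo.prod isOpen_ball⟩ with hPO
  have hPOslab :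
      (PO : Set (ℝ × EuclideanSpace ℝ (Fin 3))) ⊆
        Ioo 0 T ×ˢ (univ : Set (EuclideanSpace ℝ (Fin 3))) := by
    rintro ⟨t, x⟩ ⟨ht, -⟩
    exact ⟨⟨by linarith [ht.1], ht.2⟩, mem_univ _⟩
  have hpre1 :
      stPreimage β R T x₀ PO = parabolicCylinderOpens 1 (0 : ℝ × EuclideanSpace ℝ (Fin 3)) := by
    apply Opens.ext
    rw [coe_stPreimage]
    have h := stAffine_preimage_cylinder_eq_parabolicCylinder hν hRpos T x₀ R
    rw [div_self hRpos.ne'] at h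
    exact h
  -- suitability of the zoom on `Q(0,1)` with unit viscosity
  have hsuit1 :
      IsSuitableWeakSolutionOn (parabolicCylinderOpens 1 (0 : ℝ × EuclideanSpace ℝ (Fin 3))) 1 0
        (α • stPull β R T x₀ u) (α ^ 2 • stPull β R T x₀ q) := by
    have h0 := (isSuitableWeakSolutionOn_gauge_of_classical hν hT hsol hLH PO hPOslab).stRescale
      hαpos hRpos hβeq T x₀
    have hvisc : α * ν / R = 1 := by rw [hα, div_mul_cancel₀ R hν.ne', div_self hRpos.ne']
    have hforce :
        ((α ^ 2 * R) • stPull β R T x₀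
          (0 : ℝ → EuclideanSpace ℝ (Fin 3) → EuclideanSpace ℝ (Fin 3))) = 0 := by
      funext s y; simp [stPull]
    rw [hvisc, hforce, hpre1] at h0
    exact h0
  -- the zoomed classical gradient
  have hGu : HasWeakSpatialGradientOn PO u fun t x => fderiv ℝ (u t) x :=
    hasWeakSpatialGradientOn_of_contDiffOn isOpen_Ioo hPOslab
      ((classical_Ioo hsol).smooth_velocity.of_le (by norm_cast))
  have hGv : HasWeakSpatialGradientOn (parabolicCylinderOpens 1 (0 : ℝ × EuclideanSpace ℝ (Fin 3)))
      (α • stPull β R T x₀ u) ((α * R) • stPull β R T x₀ fun t x => fderiv ℝ (u t) x) := by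
    rw [← hpre1]
    exact hGu.stRescale α hβpos hRpos T x₀
  -- the class `IsSuitableWeakSolutionInBall 1 0`
  have hball :
      IsSuitableWeakSolutionInBall 1 0 (α • stPull β R T x₀ u) (α ^ 2 • stPull β R T x₀ q) := by
    refine ⟨hsuit1, ?_, ⟨_, hGv, ?_⟩, ?_⟩
    · -- energy class
      set CE : ENNReal := ENNReal.ofReal (2 * VectorCalculus.kineticEnergy (u 0)) with hCE
      have hphys : ∀ᵐ t ∂(volume.restrict (Ioo (T + β * (-1)) (T + β * 0))),
          ∫⁻ x in ball x₀ R, ‖u t x‖ₑ ^ 2 ≤ CE := by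
        refine (ae_restrict_mem measurableSet_Ioo).mono fun t ht => ?_
        have htI : t ∈ Icc 0 T :=
          ⟨by nlinarith [ht.1], by have := ht.2; simp at this; exact this.le⟩
        exact (setLIntegral_le_lintegral _ _).trans (eEnergy_le hν.le hLH htI)
      have h2 := ae_sliced_setLIntegral_ball_stRescale hβpos hRpos T x₀ x₀ R (-1) 0
        (fun t x => ‖u t x‖ₑ ^ 2) hphys
      rw [finrank_euclideanSpace_fin, sub_self, smul_zero, div_self hRpos.ne'] at h2
      set C₁ : ENNReal := ‖α‖ₑ ^ 2 * (ENNReal.ofReal (R ^ 3)⁻¹ * CE) with hC₁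
      have hC₁top : C₁ ≠ ⊤ :=
        ENNReal.mul_ne_top (by simp)
          (ENNReal.mul_ne_top ENNReal.ofReal_ne_top ENNReal.ofReal_ne_top)
      refine ⟨C₁.toNNReal, ?_⟩
      rw [ENNReal.coe_toNNReal hC₁top]
      have hset :
          Ioo ((0 : ℝ × EuclideanSpace ℝ (Fin 3)).1 - 1 ^ 2) (0 : ℝ × EuclideanSpace ℝ (Fin 3)).1 =
            Ioo (-1 : ℝ) 0 := by
        simp
      rw [hset]
      filter_upwards [h2] with s hs
      have e : ∀ y : EuclideanSpace ℝ (Fin 3), ‖(α • stPull β R T x₀ u) s y‖ₑ ^ 2 =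
          ‖α‖ₑ ^ 2 * ‖u (T + β * s) (x₀ + R • y)‖ₑ ^ 2 := by
        intro y
        rw [smul_stPull_apply, enorm_smul, mul_pow]
      simp only [e]
      rw [lintegral_const_mul' _ _ (by simp)]
      exact mul_le_mul' le_rfl hs
    · -- `∫_{Q(0,1)} |∇v|² < ⊤`
      have hpre : parabolicCylinder 1 (0 : ℝ × EuclideanSpace ℝ (Fin 3)) =
          stAffine β R T x₀ ⁻¹' (Ioo (T - (R * 1) ^ 2 / ν) T ×ˢ ball x₀ (R * 1)) := by
        rw [hβdef, stAffine_preimage_cylinder_eq_parabolicCylinder hν hRpos T x₀ (R * 1),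
          mul_div_cancel_left₀ (1 : ℝ) hRpos.ne']
        rfl
      rw [hpre, setLIntegral_frobeniusNormSq_stRescale hβpos hRpos T x₀ (α * R),
        finrank_euclideanSpace_fin]
      refine ENNReal.mul_lt_top (ENNReal.mul_lt_top ENNReal.ofReal_lt_top ENNReal.ofReal_lt_top) ?_
      refine lt_of_le_of_lt (lintegral_mono_set ?_)
        (lintegral_slab_frobeniusNormSq_fderiv_lt_top' hsol hLH)
      rw [mul_one]
      rintro ⟨t, x⟩ ⟨ht, -⟩
      refine ⟨⟨?_, ht.2⟩, mem_univ _⟩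
      have : R ^ 2 / ν = β := rfl
      linarith [ht.1]
    · -- `π ∈ L^{3/2}(Q(0,1))`
      refine ⟨hsuit1.distributional.2.2.1.aestronglyMeasurable, ?_⟩
      have h32 : ((3 : ENNReal) / 2).toReal = 3 / 2 := by rw [ENNReal.toReal_div]; norm_num
      have h32top : (3 : ENNReal) / 2 ≠ ⊤ := (ENNReal.div_lt_top (by simp) (by simp)).ne
      rw [eLpNorm_eq_lintegral_rpow_enorm_toReal (by norm_num) h32top, h32]
      refine ENNReal.rpow_lt_top_of_nonneg (by positivity) (ne_of_lt ?_)
      have hQ1 : parabolicCylinder 1 (0 : ℝ × EuclideanSpace ℝ (Fin 3)) =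
          stAffine β R T x₀ ⁻¹' (PO : Set (ℝ × EuclideanSpace ℝ (Fin 3))) := by
        rw [← coe_stPreimage, hpre1]; rfl
      rw [hQ1]
      show ∫⁻ z in stAffine β R T x₀ ⁻¹' (PO : Set (ℝ × EuclideanSpace ℝ (Fin 3))),
          ‖(α ^ 2 • stPull β R T x₀ q) z.1 z.2‖ₑ ^ (3 / 2 : ℝ) < ⊤
      rw [setLIntegral_enorm_rpow_stRescale hβpos hRpos T x₀ (α ^ 2) q _ (by norm_num)]
      refine ENNReal.mul_lt_top (ENNReal.mul_lt_top
        (ENNReal.rpow_lt_top_of_nonneg (by norm_num) enorm_ne_top) ENNReal.ofReal_lt_top) ?_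
      exact lt_of_le_of_lt (lintegral_mono_set hPOslab)
        (lintegral_slab_gauged_pressure_lt_top hν hT hsol hLH)
  exact ⟨hball, hGv⟩

/-- **The physical image of a parabolic sub-ball of the unit zoom ball.** Under the parabolic zoom
`Φ(s, y) = (T + R² s, x₀ + R y)`, `R > 0`, a sub-ball `Q(z', r) ⊆ Q(0, 1)` corresponds to the
physical parabolic ball `Q(Φ z', R r) ⊆ Q((T, x₀), R)`. [folklore] -/
theorem parabolicCylinder_zoom_subset {T R r : ℝ} {x₀ : (EuclideanSpace ℝ (Fin 3))} {z' : ℝ × (EuclideanSpace ℝ (Fin 3))} (hR : 0 < R)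
    (hz' : parabolicCylinder r z' ⊆ parabolicCylinder 1 (0 : ℝ × (EuclideanSpace ℝ (Fin 3)))) :
    parabolicCylinder (R * r) (stAffine (R ^ 2) R T x₀ z') ⊆ parabolicCylinder R ((T, x₀) : ℝ × (EuclideanSpace ℝ (Fin 3))) := by
  intro w hw
  have hR2 : 0 < R ^ 2 := by positivity
  -- pull `w` back along `Φ`
  set s : ℝ := (w.1 - T) / R ^ 2 with hs
  set y : (EuclideanSpace ℝ (Fin 3)) := R⁻¹ • (w.2 - x₀) with hy
  have hws : w.1 = T + R ^ 2 * s := by rw [hs]; field_simp; ring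
  have hwy : w.2 = x₀ + R • y := by
    rw [hy, smul_smul, mul_inv_cancel₀ hR.ne', one_smul]; abel
  have hmem : ((s, y) : ℝ × (EuclideanSpace ℝ (Fin 3))) ∈ parabolicCylinder r z' := by
    rw [mem_parabolicCylinder] at hw ⊢
    simp only [stAffine_fst, stAffine_snd] at hw
    obtain ⟨⟨h1, h2⟩, h3⟩ := hw
    refine ⟨⟨?_, ?_⟩, ?_⟩
    · rw [hs, lt_div_iff₀ hR2]; nlinarith
    · rw [hs, div_lt_iff₀ hR2]; nlinarith
    · rw [dist_eq_norm] at h3 ⊢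
      have e : y - z'.2 = R⁻¹ • (w.2 - (x₀ + R • z'.2)) := by
        rw [hy, smul_sub, smul_sub, smul_add, smul_smul, inv_mul_cancel₀ hR.ne', one_smul]
        abel
      rw [e, norm_smul, norm_inv, Real.norm_of_nonneg hR.le, inv_mul_lt_iff₀ hR]
      exact h3
  have h0 := hz' hmem
  rw [mem_parabolicCylinder] at h0 ⊢
  simp only [Prod.fst_zero, Prod.snd_zero, zero_sub, dist_zero_right] at h0
  obtain ⟨⟨h1, h2⟩, h3⟩ := h0
  refine ⟨⟨?_, ?_⟩, ?_⟩
  · rw [hws]; nlinarith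
  · rw [hws]; nlinarith
  · rw [dist_eq_norm, hwy, add_sub_cancel_left, norm_smul, Real.norm_of_nonneg hR.le]
    calc R * ‖y‖ < R * 1 := mul_lt_mul_of_pos_left h3 hR
      _ = R := mul_one R

/-- **A sub-ball (Morrey) cubic bound at a final-time point makes the zoom locally Type I.** For a
classical solution on `[0, T)` (`ν = 1`) which is Leray–Hopf on `[0, T)`, a point `x₀`, and a bound
`C(Q(z', r')) ≤ M₁` on EVERY parabolic sub-ball `Q(z', r') ⊆ Q_{R₀}(T, x₀)` (any centre): for a
suitable zoom radius `R ≤ R₀`, `R² ≤ T`, the parabolic zoom `v = R u ∘ Φ`, `π = R² q ∘ Φ`,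
`Φ(s, y) = (T + R² s, x₀ + R y)` (`q` the gauged pressure) is a suitable weak solution in `Q(0, 1)`
(A–B Def. 2.1) with finite Type I quantity `𝐈(Q(0, 1/2)) < ∞`: `C` is scale invariant
(`cknC_nsZoom`), so it is bounded by `M₁` on all sub-balls of `Q(0, 1)`, and the tree's
`albrittonBarker2019_lemma_2_6_holds` (`C`-case; Seregin 2006) bounds `A, D, E`.
[cite: AlbrittonBarker2019, Lemma 2.6 and Def. 2.1; Seregin2006, Lemma 2.1 (b)] -/
theorem exists_zoom_typeIBound_lt_top_of_subballC {T : ℝ} {u : ℝ → (EuclideanSpace ℝ (Fin 3)) → (EuclideanSpace ℝ (Fin 3))} {p : ℝ → (EuclideanSpace ℝ (Fin 3)) → ℝ}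
    (hT : 0 < T) (hsol : IsClassicalNSSolutionOn (Ico 0 T) 1 0 u p)
    (hLH : IsLerayHopfOn T 1 0 (u 0) u) (x₀ : (EuclideanSpace ℝ (Fin 3))) {M₁ R₀ : ℝ} (hR₀ : 0 < R₀)
    (hC : ∀ (r' : ℝ) (z' : ℝ × (EuclideanSpace ℝ (Fin 3))), 0 < r' →
      parabolicCylinder r' z' ⊆ parabolicCylinder R₀ ((T, x₀) : ℝ × (EuclideanSpace ℝ (Fin 3))) →
      cknC r' z' u ≤ ENNReal.ofReal M₁) :
    ∃ R : ℝ, 0 < R ∧ R ^ 2 / 1 ≤ T ∧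
      IsSuitableWeakSolutionInBall 1 0 ((R / 1) • stPull (R ^ 2 / 1) R T x₀ u)
        ((R / 1) ^ 2 • stPull (R ^ 2 / 1) R T x₀
          fun t x => p t x - (p t 0 - normalisedPressure (u t) 0)) ∧
      HasWeakSpatialGradientOn (parabolicCylinderOpens 1 (0 : ℝ × (EuclideanSpace ℝ (Fin 3))))
        ((R / 1) • stPull (R ^ 2 / 1) R T x₀ u)
        (((R / 1) * R) • stPull (R ^ 2 / 1) R T x₀ fun t x => fderiv ℝ (u t) x) ∧
      typeIBound (parabolicCylinder (1 / 2) (0 : ℝ × (EuclideanSpace ℝ (Fin 3)))) ((R / 1) • stPull (R ^ 2 / 1) R T x₀ u)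
        ((R / 1) ^ 2 • stPull (R ^ 2 / 1) R T x₀
          fun t x => p t x - (p t 0 - normalisedPressure (u t) 0))
        (((R / 1) * R) • stPull (R ^ 2 / 1) R T x₀ fun t x => fderiv ℝ (u t) x) < ⊤ := by
  -- the zoom radius: `R ≤ R₀`, `R² ≤ T`
  set R : ℝ := min R₀ (Real.sqrt T) with hR
  have hRpos : 0 < R := lt_min hR₀ (Real.sqrt_pos.2 hT)
  have hRR₀ : R ≤ R₀ := min_le_left _ _
  have hRT : R ^ 2 / 1 ≤ T := by
    rw [div_one]
    have h1 : R ≤ Real.sqrt T := min_le_right _ _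
    have h2 := pow_le_pow_left₀ hRpos.le h1 2
    rwa [Real.sq_sqrt hT.le] at h2
  obtain ⟨hball, hGv⟩ := exists_zoom_suitableInBall one_pos hT hsol hLH x₀ hRpos hRT
  refine ⟨R, hRpos, hRT, hball, hGv, ?_⟩
  -- `C` on every parabolic sub-ball of `Q(0,1)` by scale invariance
  have hCsup : (⨆ (r : ℝ) (_ : 0 < r) (z' : ℝ × (EuclideanSpace ℝ (Fin 3)))
      (_ : parabolicCylinder r z' ⊆ parabolicCylinder 1 (0 : ℝ × (EuclideanSpace ℝ (Fin 3)))),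
        cknC r z' ((R / 1) • stPull (R ^ 2 / 1) R T x₀ u)) < ⊤ := by
    refine lt_of_le_of_lt ?_ (ENNReal.ofReal_lt_top (r := M₁))
    refine iSup_le fun r => iSup_le fun hr => iSup_le fun z' => iSup_le fun hz' => ?_
    rw [div_one, div_one, cknC_nsZoom hRpos hr T x₀ z' u]
    exact hC (R * r) _ (by positivity)
      ((parabolicCylinder_zoom_subset hRpos hz').trans (parabolicCylinder_mono hRpos.le hRR₀ _))
  exact albrittonBarker2019_lemma_2_6_holds 0 _ _ hball _ hGv (Or.inr (Or.inl hCsup)) (1 / 2)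
    (by norm_num) (by norm_num)

-- adapted from Literature/Analysis/FluidPDE/SereginSverakPressureLocalTypeI.lean
-- (`seregin_sverak_2002_of_not_localTypeISingularityExists`, final block)

/-- **`S1_sup` with a sub-ball (Morrey) cubic hypothesis, from the SHARED conjecture
`¬ LocalTypeISingularityExists`.** If no suitable weak solution of the unforced unit-viscosity
Navier–Stokes system has a local Type I singular point in the sense of Albritton–Barker 2019,
Thm. 1.1 (first bullet), then for every classical Leray–Hopf solution (`ν = 1`) on `ℝ³ × [0, T)` from
a rapidly decaying datum and every `x₀`: a bound `C(Q(z', r')) ≤ M₁` on all parabolic sub-balls of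
some `Q_{R₀}(T, x₀)` forces `u` to be bounded near `(T, x₀)` — otherwise the origin would be a
backward singular point of the zoom of `exists_zoom_typeIBound_lt_top_of_subballC`
(`SereginSverak2002.isBackwardBoundedAt_of_zoom`, continuity below `T`), i.e. a local Type I
singular point. Compare `supForm_of_not_typeISingularityExists` (centred hypothesis, centred
conjecture). [cite: AlbrittonBarker2019, Thm. 1.1 and Lemma 2.6; SereginSverak2009, §2] -/
theorem supForm_of_not_localTypeISingularityExists_of_subballC :
    ¬ Literature.Analysis.FluidPDE.LocalTypeISingularityExists →
      ∀ T : ℝ, 0 < T →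
        ∀ (u : ℝ → EuclideanSpace ℝ (Fin 3) → EuclideanSpace ℝ (Fin 3))
          (p : ℝ → EuclideanSpace ℝ (Fin 3) → ℝ),
          Literature.Analysis.FluidPDE.IsClassicalNSSolutionOn (Set.Ico 0 T) 1 0 u p →
          Literature.Analysis.FluidPDE.IsLerayHopfOn T 1 0 (u 0) u →
          Literature.Analysis.FluidPDE.HasRapidSpatialDecay (u 0) →
          ∀ x₀ : EuclideanSpace ℝ (Fin 3),
            (∃ M₁ R₀ : ℝ, 0 < R₀ ∧ ∀ (r' : ℝ) (z' : ℝ × EuclideanSpace ℝ (Fin 3)), 0 < r' →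
              Literature.Analysis.FluidPDE.parabolicCylinder r' z' ⊆
                Literature.Analysis.FluidPDE.parabolicCylinder R₀ ((T, x₀) : ℝ × EuclideanSpace ℝ (Fin 3)) →
              Literature.Analysis.FluidPDE.cknC r' z' u ≤ ENNReal.ofReal M₁) →
            ∃ ρ : ℝ, 0 < ρ ∧ ∃ M : ℝ, ∀ t ∈ Set.Ioo (T - ρ ^ 2) T,
              ∀ x ∈ Metric.ball x₀ ρ, ‖u t x‖ ≤ M := by
  intro hno T hT u p hsol hLH _hdec x₀ hMorrey
  obtain ⟨M₁, R₀, hR₀, hC⟩ := hMorrey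
  obtain ⟨R, hR, hRT, hball, hGv, htypeI⟩ :=
    exists_zoom_typeIBound_lt_top_of_subballC hT hsol hLH x₀ hR₀ hC
  by_contra hnot
  apply hno
  have hnot' : ¬ IsBackwardBoundedAt u T x₀ := fun ⟨r, hr, C, hC'⟩ => hnot ⟨r, hr, C, hC'⟩
  have hα : 0 < R / 1 := by positivity
  have hβ : 0 < R ^ 2 / 1 := by positivity
  have hsing : IsBackwardSingularPoint ((R / 1) • stPull (R ^ 2 / 1) R T x₀ u) (0 : ℝ × (EuclideanSpace ℝ (Fin 3))) := by
    intro r hr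
    by_contra hfin
    have hfin' : eLpNorm (uncurry ((R / 1) • stPull (R ^ 2 / 1) R T x₀ u)) ⊤
        (volume.restrict (parabolicCylinder (min r 1) (0 : ℝ × (EuclideanSpace ℝ (Fin 3))))) < ⊤ := by
      refine lt_of_le_of_lt (eLpNorm_mono_measure _ (Measure.restrict_mono ?_ le_rfl))
        (lt_top_iff_ne_top.2 hfin)
      exact SuitableCompactness.parabolicCylinder_zero_mono (le_min hr.le zero_le_one)
        (min_le_left _ _)
    exact hnot' (isBackwardBoundedAt_of_zoom hsol x₀ hR hα hβ hRT (lt_min hr one_pos)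
      (min_le_right _ _) hfin')
  refine ⟨1 / 2, 0, (R / 1) • stPull (R ^ 2 / 1) R T x₀ u,
    (R / 1) ^ 2 • stPull (R ^ 2 / 1) R T x₀ (fun t x => p t x - (p t 0 - normalisedPressure (u t) 0)),
    by norm_num, ?_, hsing, _,
    hGv.mono (SuitableCompactness.parabolicCylinderOpens_zero_mono (by norm_num) (by norm_num)),
    htypeI⟩
  exact SuitableCompactness.isSuitableWeakSolutionInBall_of_le_radius hball (by norm_num)
    (by norm_num)

end Summit.NavierStokesRegularity.NavierStokesRegularity.Theorems.SequentialTypeIExclusion.Registered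

end
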